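import Mathlib.RingTheory.ZariskisMainTheorem
import Mathlib.RingTheory.IntegralClosure.IntegrallyClosed
import Mathlib.RingTheory.EssentialFiniteness
import Mathlib.RingTheory.Spectrum.Prime.Jacobson
import Mathlib.RingTheory.LocalRing.ResidueField.Fiber
import Mathlib.RingTheory.Localization.AtPrime.Basic
import Mathlib.RingTheory.Polynomial.Basic
import HarnessLib

/-!
# Zariski's Main Theorem, birational form: quasi-finite and birational over a normal local ring is an isomorphism

Topic: `Literature/AlgebraicGeometry/Resolution`. Pure commutative algebra serving the last
paragraph of Cossart–Piltant 2019, proof of journal Prop. 4.8 = arXiv v1 Prop. 4.6 (p. 53):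

> "There are inclusions `Â ⊂ T'_{P'} ⊆ 𝒪_{Ŷ,ŷ}`. By (5101)-(5102), the right-hand side
> inclusion satisfies `√(P'𝒪_{Ŷ,ŷ}) = m_ŷ`, so `𝒪_{Ŷ,ŷ} = T'_{P'}` and the proof is complete."

Here `T'_{P'}` is a NORMAL local domain, `𝒪_{Ŷ,ŷ}` is a local ring essentially of finite type
over it (a local ring of the resolution `Ŷ → Spec Â`), contained in its fraction field
(birational), the maximal ideal of `T'_{P'}` generates an `m_ŷ`-primary ideal and the residue
field of `ŷ` is algebraic over that of `P'` (it embeds in `k_v̂`, algebraic over `k`). The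
unstated justification of "so" is Zariski's Main Theorem: `ŷ` is isolated in its fibre, hence
`𝒪_{Ŷ,ŷ}` is a localisation of the integral closure of `T'_{P'}` in it (Grothendieck's
algebraic form, Stacks 00Q9, in Mathlib as `Algebra.ZariskisMainProperty.of_finiteType`),
which is `T'_{P'}` itself by normality and birationality.

Everything here is PROVED (no definitions, no named facts):

* `exists_algebraMap_eq_of_isIntegral_of_injective` — an element of a birational extension
  `R ⊆ S ⊆ Frac R` which is integral over the integrally closed domain `R` lies in `R`;
* `exists_forall_exists_algebraMap_eq_pow_mul_of_quasiFiniteAt` — **ZMT, birational form**: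
  `S` of finite type and birational over an integrally closed domain `R`, quasi-finite at a
  prime `𝔮` ⇒ `S[1/r] = R[1/r]` for some `r ∈ R ∖ 𝔮`;
* `bijective_algebraMap_of_quasiFiniteAt_of_under_eq_maximalIdeal` — if moreover `R` is local
  and `𝔮` lies over its maximal ideal then `R = S`;
* `quasiFiniteAt_of_isMaximal_of_forall_le` — a prime of a finite type algebra over a local
  ring which is maximal, lies over the maximal ideal and is minimal among such primes is
  quasi-finite (Stacks 00PK (5) ⇒ (1): a closed point of the fibre of dimension `0` there is
  isolated in its fibre);
* `bijective_algebraMap_of_essFiniteType_of_forall_isPrime` — **the local statement used by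
  Cossart–Piltant**: `N` an integrally closed local domain, `S` a local ring essentially of
  finite type over `N`, `N → S` local and birational (`S` embeds into `Frac N` over `N`),
  `m_N S` is `m_S`-primary (every prime of `S` containing `m_N S` is `m_S`) and the residue
  field of `S` is algebraic over that of `N` (elementary rendering: every `x ∈ S` is a root
  modulo `m_S` of a polynomial over `N` with a coefficient outside `m_N`) ⇒ `N → S` is bijective.

## Sources

* V. Cossart, O. Piltant, J. Algebra 529 (2019) 268–535 = arXiv:1412.0868, end of the proof of
  Prop. 4.8 (arXiv v1: Prop. 4.6, p. 53). [CossartPiltant2019]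
* The Stacks Project, Tag 00Q9 (Zariski's Main Theorem, algebraic version), Tag 00PK
  (equivalent conditions for isolated points in fibres), Tags 00PL, 00PM (quasi-finite),
  Tag 0AB1 (finite birational over normal is an isomorphism). [StacksProject]
-/

noncomputable section

open IsLocalRing Polynomial

namespace Literature.AlgebraicGeometry.Resolution

universe u

/-! ## Integral elements of birational extensions of a normal domain -/

section Birational

variable {R S K : Type u} [CommRing R] [CommRing S] [Algebra R S] [Field K] [Algebra R K]
  [Algebra S K] [IsScalarTower R S K]

/-- If `R` is an integrally closed domain with fraction field `K` and `S` is an `R`-algebra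
embedded in `K` over `R` (a *birational* extension), then every element of `S` integral over `R`
comes from `R`. [folklore] -/
theorem exists_algebraMap_eq_of_isIntegral_of_injective [IsDomain R] [IsIntegrallyClosed R]
    [IsFractionRing R K] (hSK : Function.Injective (algebraMap S K)) {x : S}
    (hx : IsIntegral R x) : ∃ a : R, algebraMap R S a = x := by
  have hK : IsIntegral R (algebraMap S K x) := hx.algebraMap
  obtain ⟨a, ha⟩ := (isIntegrallyClosed_iff K).mp ‹IsIntegrallyClosed R› hK
  refine ⟨a, hSK ?_⟩
  rw [← IsScalarTower.algebraMap_apply]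
  exact ha

/-- Injectivity of `R → S` for a birational extension `R → S → K = Frac R`. [folklore] -/
theorem injective_algebraMap_of_isScalarTower_fractionRing [IsDomain R] [IsFractionRing R K] :
    Function.Injective (algebraMap R S) := by
  intro a b hab
  apply IsFractionRing.injective R K
  rw [IsScalarTower.algebraMap_apply R S K, hab, ← IsScalarTower.algebraMap_apply]

/-! ## Zariski's Main Theorem, birational form -/

/-- **Zariski's Main Theorem, birational form** (Grothendieck's algebraic ZMT, Stacks 00Q9, over
a normal base): let `R` be an integrally closed domain with fraction field `K`, `S` an
`R`-algebra of finite type embedded in `K` over `R`, and `𝔮` a prime of `S` at which `S` is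
quasi-finite over `R`. Then there is `r ∈ R` with `r ∉ 𝔮` such that every `x ∈ S` satisfies
`rⁿ x ∈ R` for some `n`, i.e. `S[1/r] = R[1/r]`: by ZMT there is such an `r` in the integral
closure of `R` in `S` with `rⁿx` integral over `R`, and integral elements of `S ⊆ Frac R` lie in
`R`. [cite: StacksProject, Tag 00Q9] -/
theorem exists_forall_exists_algebraMap_eq_pow_mul_of_quasiFiniteAt [IsDomain R]
    [IsIntegrallyClosed R] [IsFractionRing R K] [Algebra.FiniteType R S]
    (hSK : Function.Injective (algebraMap S K)) (q : Ideal S) [q.IsPrime]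
    [Algebra.QuasiFiniteAt R q] :
    ∃ r : R, algebraMap R S r ∉ q ∧
      ∀ x : S, ∃ (n : ℕ) (a : R), algebraMap R S a = algebraMap R S r ^ n * x := by
  obtain ⟨r, hrq, hrint, H⟩ :=
    Algebra.zariskisMainProperty_iff.mp (Algebra.ZariskisMainProperty.of_finiteType (R := R) q)
  obtain ⟨r₀, rfl⟩ := exists_algebraMap_eq_of_isIntegral_of_injective hSK hrint
  refine ⟨r₀, hrq, fun x => ?_⟩
  obtain ⟨m, hm⟩ := H x
  obtain ⟨a, ha⟩ := exists_algebraMap_eq_of_isIntegral_of_injective hSK hm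
  exact ⟨m, a, ha⟩

/-- **ZMT, birational form over a normal LOCAL ring**: with `R`, `S ⊆ Frac R`, `𝔮` as above, if
`R` is local and `𝔮` lies over the maximal ideal of `R`, then `R → S` is bijective (the element
`r ∈ R ∖ 𝔪_R` of the previous statement is a unit). [cite: StacksProject, Tag 00Q9] -/
theorem bijective_algebraMap_of_quasiFiniteAt_of_under_eq_maximalIdeal [IsDomain R]
    [IsIntegrallyClosed R] [IsLocalRing R] [IsFractionRing R K] [Algebra.FiniteType R S]
    (hSK : Function.Injective (algebraMap S K)) (q : Ideal S) [q.IsPrime]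
    (hq : q.under R = maximalIdeal R) [Algebra.QuasiFiniteAt R q] :
    Function.Bijective (algebraMap R S) := by
  refine ⟨injective_algebraMap_of_isScalarTower_fractionRing (K := K), fun x => ?_⟩
  obtain ⟨r, hrq, H⟩ :=
    exists_forall_exists_algebraMap_eq_pow_mul_of_quasiFiniteAt (R := R) hSK q
  have hr : IsUnit r := by
    by_contra h
    apply hrq
    have hmem : r ∈ q.under R := by
      rw [hq]
      exact (IsLocalRing.mem_maximalIdeal r).mpr h
    exact hmem
  obtain ⟨n, a, ha⟩ := H x
  refine ⟨((hr.unit⁻¹ : Rˣ) : R) ^ n * a, ?_⟩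
  have h1 : algebraMap R S ((hr.unit⁻¹ : Rˣ) : R) * algebraMap R S r = 1 := by
    rw [← map_mul, IsUnit.val_inv_mul, map_one]
  calc algebraMap R S (((hr.unit⁻¹ : Rˣ) : R) ^ n * a)
      = (algebraMap R S ((hr.unit⁻¹ : Rˣ) : R)) ^ n * (algebraMap R S r ^ n * x) := by
        rw [map_mul, map_pow, ha]
    _ = (algebraMap R S ((hr.unit⁻¹ : Rˣ) : R) * algebraMap R S r) ^ n * x := by
        rw [mul_pow]; ring
    _ = x := by rw [h1, one_pow, one_mul]

end Birational

/-! ## Isolated points of the closed fibre are quasi-finite -/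

section QuasiFinite

variable {N S : Type u} [CommRing N] [IsLocalRing N] [CommRing S] [Algebra N S]

/-- **A closed point of dimension zero of the closed fibre is isolated, hence quasi-finite**
(Stacks 00PK, (5) ⇒ (1), with 00PM): over a local ring `N`, a prime `𝔮` of a finite type
`N`-algebra `S` which is a maximal ideal lying over `𝔪_N` and is minimal among the primes over
`𝔪_N` contained in it is both closed and stable under generalization in the closed fibre
`Spec (κ(𝔪_N) ⊗_N S)` (a Jacobson Noetherian space), hence open there, so `S` is quasi-finite
at `𝔮`. [cite: StacksProject, Tag 00PK] -/
theorem quasiFiniteAt_of_isMaximal_of_forall_le [Algebra.FiniteType N S] (q : Ideal S)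
    [hqmax : q.IsMaximal] (hq : q.under N = maximalIdeal N)
    (hmin : ∀ P : Ideal S, P.IsPrime → P ≤ q → maximalIdeal N ≤ P.under N → P = q) :
    Algebra.QuasiFiniteAt N q := by
  set m : Ideal N := maximalIdeal N with hm
  haveI : q.LiesOver m := ⟨hq.symm⟩
  -- the point of the fibre ring corresponding to `𝔮`
  let q₀ : m.primesOver S := ⟨q, inferInstance, inferInstance⟩
  let e := PrimeSpectrum.primesOverOrderIsoFiber N S m
  let Q : PrimeSpectrum (m.Fiber S) := e q₀
  have hQ : Q.asIdeal.comap (Algebra.TensorProduct.includeRight : S →ₐ[N] m.Fiber S) = q := by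
    have h1 := PrimeSpectrum.coe_primesOverOrderIsoFiber_symm_apply (R := N) (S := S) m Q
    rw [OrderIso.symm_apply_apply] at h1
    exact h1.symm
  -- `q₀` is maximal and minimal among the primes over `𝔪_N`
  have hmaxq₀ : IsMax q₀ := by
    intro y hy
    have hle : (q : Ideal S) ≤ y.1 := hy
    haveI : y.1.IsPrime := y.2.1
    exact le_of_eq (Subtype.ext (hqmax.eq_of_le y.2.1.ne_top hle).symm)
  have hminq₀ : IsMin q₀ := by
    intro y hy
    have hle : y.1 ≤ q := hy
    haveI : y.1.IsPrime := y.2.1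
    have hover : maximalIdeal N ≤ y.1.under N := by
      rw [← y.2.2.over]
    exact le_of_eq (Subtype.ext (hmin y.1 y.2.1 hle hover).symm)
  have hmaxQ : IsMax Q := (e.isMax_apply).mpr hmaxq₀
  have hminQ : IsMin Q := (e.isMin_apply).mpr hminq₀
  -- hence `{Q}` is open in the (Jacobson, Noetherian) fibre
  haveI : IsNoetherianRing (m.Fiber S) := Algebra.FiniteType.isNoetherianRing m.ResidueField _
  haveI : IsJacobsonRing (m.Fiber S) := isJacobsonRing_of_finiteType (A := m.ResidueField)
  have hopen : IsOpen ({Q} : Set (PrimeSpectrum (m.Fiber S))) := by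
    have h1 : IsClosed ({Q} : Set (PrimeSpectrum (m.Fiber S))) := by
      rw [PrimeSpectrum.isClosed_singleton_iff_isMaximal]
      exact PrimeSpectrum.isMax_iff.mp hmaxQ
    have h2 : StableUnderGeneralization ({Q} : Set (PrimeSpectrum (m.Fiber S))) := by
      rw [PrimeSpectrum.stableUnderGeneralization_singleton]
      exact PrimeSpectrum.isMin_iff.mp hminQ
    have h3 := PrimeSpectrum.isOpen_singleton_tfae_of_isNoetherian_of_isJacobsonRing Q
    have h4 : IsOpen ({Q} : Set (PrimeSpectrum (m.Fiber S))) ↔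
        IsClosed ({Q} : Set (PrimeSpectrum (m.Fiber S))) ∧
          StableUnderGeneralization ({Q} : Set (PrimeSpectrum (m.Fiber S))) := h3.out 0 2
    exact h4.mpr ⟨h1, h2⟩
  haveI : Algebra.QuasiFiniteAt m.ResidueField Q.asIdeal :=
    Algebra.QuasiFiniteAt.of_isOpen_singleton Q hopen
  exact Algebra.QuasiFiniteAt.of_quasiFiniteAt_residueField m q Q.asIdeal hQ

end QuasiFinite

/-! ## The local statement for algebras essentially of finite type -/

section EssFiniteType

variable {N S K : Type u} [CommRing N] [IsLocalRing N] [CommRing S] [IsLocalRing S] [Algebra N S]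
  [Field K] [Algebra N K] [Algebra S K] [IsScalarTower N S K]

omit [IsLocalRing N] in
/-- For a local ring `S` essentially of finite type over `N`, written as a localisation of the
finite type subalgebra `S₀ = N[σ] ⊆ S` (`Algebra.EssFiniteType.subalgebra`), `S` is the
localisation of `S₀` at the prime `𝔮 = 𝔪_S ∩ S₀`. [folklore] -/
theorem isLocalization_atPrime_comap_maximalIdeal [Algebra.EssFiniteType N S] :
    IsLocalization.AtPrime S
      ((maximalIdeal S).comap (algebraMap (Algebra.EssFiniteType.subalgebra N S) S)) := by
  set S₀ := Algebra.EssFiniteType.subalgebra N S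
  set q : Ideal S₀ := (maximalIdeal S).comap (algebraMap S₀ S) with hqdef
  have hM : Algebra.EssFiniteType.submonoid N S = q.primeCompl := by
    ext x
    change x ∈ (IsUnit.submonoid S).comap (algebraMap S₀ S) ↔ x ∉ q
    rw [Submonoid.mem_comap, IsUnit.mem_submonoid_iff, hqdef, Ideal.mem_comap,
      IsLocalRing.notMem_maximalIdeal]
  have inst : IsLocalization (Algebra.EssFiniteType.submonoid N S) S := inferInstance
  rw [hM] at inst
  exact inst

/-- **Cossart–Piltant's "so `𝒪_{Ŷ,ŷ} = T'_{P'}`"** (end of the proof of Prop. 4.8 = arXiv v1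
Prop. 4.6; Zariski's Main Theorem in Grothendieck's algebraic form, Stacks 00Q9, over a normal
local base, cf. Stacks 0AB1): let `N` be an integrally closed local domain with fraction field `K`, `S` a
local ring essentially of finite type over `N` with `N → S` local, embedded in `K` over `N`
(birational). Assume that every prime of `S` containing `𝔪_N S` equals `𝔪_S`
(`√(𝔪_N S) = 𝔪_S`) and that every element of `S` is a root modulo `𝔪_S` of a polynomial over
`N` with a coefficient outside `𝔪_N` (the residue field of `S` is algebraic over that of `N`).
Then `N → S` is bijective. Proof: `S = (S₀)_𝔮` for a finite type `S₀ ⊆ S`; `𝔮` is maximal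
(`S₀/𝔮 ⊆ κ(S)` is a domain algebraic over the field `N/𝔪_N`), lies over `𝔪_N` and is minimal
among such primes, so `S₀` is quasi-finite at `𝔮` (`quasiFiniteAt_of_isMaximal_of_forall_le`);
by the birational ZMT `N = S₀`, a local ring, and `𝔮 = 𝔪_{S₀}`, so `S = (S₀)_𝔮 = S₀ = N`.
[cite: CossartPiltant2019, end of proof of Prop. 4.8 (arXiv v1: Prop. 4.6, p. 53)]
[cite: StacksProject, Tag 00Q9] -/
theorem bijective_algebraMap_of_essFiniteType_of_forall_isPrime [IsDomain N]
    [IsIntegrallyClosed N] [IsFractionRing N K] [Algebra.EssFiniteType N S]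
    [IsLocalHom (algebraMap N S)] (hSK : Function.Injective (algebraMap S K))
    (hrad : ∀ P : Ideal S, P.IsPrime → (maximalIdeal N).map (algebraMap N S) ≤ P →
      P = maximalIdeal S)
    (halg : ∀ x : S, ∃ p : N[X], (∃ i, p.coeff i ∉ maximalIdeal N) ∧
      p.eval₂ (algebraMap N S) x ∈ maximalIdeal S) :
    Function.Bijective (algebraMap N S) := by
  classical
  set S₀ := Algebra.EssFiniteType.subalgebra N S with hS₀def
  set q : Ideal S₀ := (maximalIdeal S).comap (algebraMap S₀ S) with hqdef
  haveI : q.IsPrime := Ideal.IsPrime.comap _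
  haveI hloc : IsLocalization.AtPrime S q := isLocalization_atPrime_comap_maximalIdeal
  -- `N → S₀ → S → K` (`S₀ ⊆ S` acts on `K` through `S`)
  have hS₀Kdef : ∀ x : S₀, algebraMap S₀ K x = algebraMap S K (x : S) := fun _ => rfl
  haveI : IsScalarTower S₀ S K := IsScalarTower.of_algebraMap_eq fun x => hS₀Kdef x
  haveI : IsScalarTower N S₀ K := IsScalarTower.of_algebraMap_eq fun x => by
    rw [hS₀Kdef]
    have hx : ((algebraMap N S₀ x : S₀) : S) = algebraMap N S x := rfl
    rw [hx, ← IsScalarTower.algebraMap_apply]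
  have hS₀K : Function.Injective (algebraMap S₀ K) := by
    intro x y hxy
    rw [hS₀Kdef, hS₀Kdef] at hxy
    exact Subtype.ext (hSK hxy)
  -- `𝔮 ∩ N = 𝔪_N`
  have hmS : (maximalIdeal S).comap (algebraMap N S) = maximalIdeal N := by
    ext x
    rw [Ideal.mem_comap, IsLocalRing.mem_maximalIdeal, IsLocalRing.mem_maximalIdeal,
      mem_nonunits_iff, mem_nonunits_iff, isUnit_map_iff]
  have hq : q.under N = maximalIdeal N := by
    rw [Ideal.under, hqdef, Ideal.comap_comap, ← IsScalarTower.algebraMap_eq N S₀ S, hmS]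
  -- `𝔮` is maximal: `S₀/𝔮` is a domain algebraic over the field `N/𝔪_N`
  have hqmax : q.IsMaximal := by
    apply Ideal.Quotient.maximal_of_isField
    set k := ResidueField N
    have hle : maximalIdeal N ≤ q.comap (algebraMap N S₀) := by rw [← Ideal.under, hq]
    let φ : k →+* S₀ ⧸ q := Ideal.quotientMap q (algebraMap N S₀) hle
    letI : Algebra k (S₀ ⧸ q) := φ.toAlgebra
    haveI : Algebra.IsIntegral k (S₀ ⧸ q) := by
      rw [← Algebra.isAlgebraic_iff_isIntegral]
      refine ⟨fun y => ?_⟩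
      obtain ⟨y, rfl⟩ := Ideal.Quotient.mk_surjective y
      obtain ⟨p, ⟨i, hi⟩, hp⟩ := halg (y : S)
      refine ⟨p.map (algebraMap N k), ?_, ?_⟩
      · intro h0
        apply hi
        have : (p.map (algebraMap N k)).coeff i = 0 := by rw [h0, coeff_zero]
        rw [coeff_map] at this
        exact (IsLocalRing.residue_eq_zero_iff _).mp this
      · have h1 : (Ideal.Quotient.mk q) (p.eval₂ (algebraMap N S₀) y) = 0 := by
          rw [Ideal.Quotient.eq_zero_iff_mem, hqdef, Ideal.mem_comap, Polynomial.hom_eval₂,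
            ← IsScalarTower.algebraMap_eq N S₀ S]
          exact hp
        rw [aeval_def, eval₂_map, RingHom.algebraMap_toAlgebra]
        have h2 : (φ.comp (algebraMap N k)) = (Ideal.Quotient.mk q).comp (algebraMap N S₀) := by
          ext x; rfl
        rw [h2, ← Polynomial.hom_eval₂, h1]
    exact isField_of_isIntegral_of_isField' (R := k) (S := S₀ ⧸ q) (Field.toIsField k)
  -- `𝔮` is minimal among the primes over `𝔪_N`
  have hmin : ∀ P : Ideal S₀, P.IsPrime → P ≤ q → maximalIdeal N ≤ P.under N → P = q := by
    intro P hP hPq hover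
    have hdisj : Disjoint (q.primeCompl : Set S₀) P := by
      rw [Set.disjoint_left]
      intro x hx hxP
      exact hx (hPq hxP)
    haveI : (P.map (algebraMap S₀ S)).IsPrime :=
      IsLocalization.isPrime_of_isPrime_disjoint q.primeCompl S P hP hdisj
    have hP' : P.map (algebraMap S₀ S) = maximalIdeal S := by
      refine hrad _ inferInstance ?_
      rw [Ideal.map_le_iff_le_comap]
      intro x hx
      have hx' : algebraMap N S₀ x ∈ P := hover hx
      rw [Ideal.mem_comap, IsScalarTower.algebraMap_apply N S₀ S]
      exact Ideal.mem_map_of_mem _ hx'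
    have := IsLocalization.under_map_of_isPrime_disjoint q.primeCompl S hP hdisj
    rw [hP'] at this
    rw [← this, hqdef, Ideal.under]
  -- `S₀` is quasi-finite at `𝔮`, so `N = S₀` by the birational ZMT
  haveI : Algebra.QuasiFiniteAt N q :=
    quasiFiniteAt_of_isMaximal_of_forall_le q hq hmin
  have hbij : Function.Bijective (algebraMap N S₀) :=
    bijective_algebraMap_of_quasiFiniteAt_of_under_eq_maximalIdeal (K := K) hS₀K q hq
  -- every element of `S₀ ∖ 𝔮` is a unit of `S₀`, so `S = (S₀)_𝔮 = S₀`
  have hunits : ∀ x : q.primeCompl, IsUnit (x : S₀) := by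
    rintro ⟨x, hx⟩
    obtain ⟨a, rfl⟩ := hbij.2 x
    have ha : a ∉ maximalIdeal N := by
      intro h
      apply hx
      have : algebraMap N S₀ a ∈ q := by
        rw [← hq] at h
        exact h
      exact this
    exact (IsLocalRing.notMem_maximalIdeal.mp ha).map _
  have hle : q.primeCompl ≤ IsUnit.submonoid S₀ := fun x hx => hunits ⟨x, hx⟩
  let e : S₀ ≃ₐ[S₀] S := IsLocalization.atUnits S₀ q.primeCompl hle
  have hbij₀ : Function.Bijective (algebraMap S₀ S) := by
    have : (algebraMap S₀ S : S₀ → S) = e := funext fun x => (e.commutes x).symm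
    rw [this]
    exact e.bijective
  have hcomp : (algebraMap N S : N → S) = algebraMap S₀ S ∘ algebraMap N S₀ :=
    funext fun x => IsScalarTower.algebraMap_apply N S₀ S x
  rw [hcomp]
  exact hbij₀.comp hbij

end EssFiniteType

end Literature.AlgebraicGeometry.Resolution
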